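import Summits.QuantumFields.BalabanUV.T4Continuum.Support.CTGaugeTerm
import Literature.MathematicalPhysics.QuantumFieldTheory.Balaban1983to89.Beta.DeltaACombesThomasSets
import Summits.QuantumFields.BalabanUV.Beta.AccretiveCombesThomas
import Literature.MathematicalPhysics.QuantumFieldTheory.Balaban1983to89.B5RealFields

/-!
# T⁴ programme, SUBSTRATE (shared lattice-gauge analysis library) — LEVEL-FREE ℓ²-DECAY OF BAŁABAN's VECTOR PROPAGATOR `𝒢(a) = Δ_a⁻¹`,
# `Δ_a = Δ − ∂P∂* + aQ*Q` ([B5] (1.69)) AT `U = 1`, WITH NO (1.126)-TYPE HYPOTHESIS: the projection term enters through the operator-level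
# conjugation defect of `CTGaugeTerm`, not through a kernel bound (programme VEC, file 6 — the goal of the programme)

Substrate cell `b2b-balaban-substrate-*`, seat p3.  `Beta.DeltaACombesThomasSets.calG_setDecay` proves the set-to-set decay of `𝒢(a)` MODULO the
displayed hypothesis `hP : ∀ e, ctRowDefect (∂·PcT·∂ᴴ) κ ρ e ≤ J_P` (the (1.126)-type ROW-DEFECT bound of the non-local projection term, which an
ℓ²-toolbox cannot supply).  THIS FILE removes it: with a `1/n`-Lipschitz SITE weight `ρ₀` of block oscillation `≤ Λ` lifted to bonds
(`ρ_b = bondW₀ ρ₀`),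
 * §1 the three conjugation defects of `Δ_a = Δ − ∂PcT∂ᴴ + a·Q*Q`: `conjDefect_Lap` (`d·κ²e^{κ²/2}`, `ctRowDefect_Lap_le_uniform`), `conjDefect_mass`
   (`|a|·(cosh(2(d+1)κ) − 1)`, `ctRowDefect_QvAdj_QvOp_le` + `stencil_osc_of_lipschitz`), `conjDefect_gaugeTerm` (`EK d a′ κ Λ`, SOURCE 2:
   `CTGaugeTerm.opNorm_conjMat_gaugeTerm_sub_le` + `conjDefect_of_opNorm`), whence **`conjDefect_DeltaA`** with budget
   **`JA d a a′ κ Λ = d·κ²e^{κ²/2} + EK d a′ κ Λ + |a|·(cosh(2(d+1)κ) − 1)`** and **`wCoercive_DeltaA`**: `WCoercive (DeltaA n M a) κ ρ_b (gammaA d a − JA)`;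
 * §2 **`calG_pairing_decay`** (`|⟨u, 𝒢(a)v⟩| ≤ e^{−κr}/(γ_A − JA)·‖u‖‖v‖`, `v` on `{ρ₀ ≤ 0}`, `u` on `{ρ₀ ≥ r}`), and with the distance weight
   `ρ₀ = ScalarCovariantCoercive.rhoS T` (`Λ = 1`): **`calG_setDecay'`**, **`calG_entry_decay'`**:
   `‖𝒢(a)((x,μ),(x′,ν))‖ ≤ e^{−κ·dist_∞(x,x′)/n}/(gammaA d a − JA d a a′ κ 1)` for every `κ ≥ 0` meeting the three SMALLNESS conditions
   `Jfree d a′ κ 1 < γ′`, `deltaK d a′ κ 1 < σ₀²`, `JA d a a′ κ 1 < gammaA d a` (all hold for small `κ`: `JA`, `deltaK`, `Jfree` vanish at `κ = 0` and are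
   built from `|κ|`, `κ²`, `e^{|κ|·}`, `cosh`) — constants depending on `(d, a, a′)` only; `a′ > 0` is the free auxiliary mass of the
   factorisation `∂PcT∂ᴴ = ∂·Pone(a′)·∂ᴴ` (`a′ = 1` is a fine choice).
What is NOT here: an explicit admissible rate `κ_A(d, a)` (a follower: linearise `JA`), `U ≠ 1` (the covariant vector operator WITH gauge term).

HONEST FRAMING (T4-DAG p. 1).  MODEL level: `U = 1`, one region, ℓ²-pairing ∕ entry norms, route = operator-level Combes–Thomas (OURS); NOT [B5] Prop. 1.2 ∕
(1.126) as printed; nothing printed is a hypothesis; no `def … : Prop`; spine 0/9 unchanged; NOT infinite volume ∕ mass gap ∕ Clay.  HONEST DEPENDENCY: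
continuum YM on T⁴ ⇐ BetaPertH ∧ nine spine estimates (0/9 proved); BetaPertH ⇐ (D1) ∧ (D4) ∧ CAP+tail; G-an2-4 gates asym, D1 and NE2/3/4.  ABSOLUTE RULE
kept; no `sorry`.
-/

noncomputable section

open scoped BigOperators ComplexConjugate Matrix Matrix.Norms.L2Operator ComplexOrder

namespace Summit.QuantumFields.BalabanUV.T4Continuum.CTVectorPropagator

open Literature.MathematicalPhysics.QuantumFieldTheory.Balaban1983to89.B5Prop11Plancherel (Tor fine unitVec calG)
open Literature.MathematicalPhysics.QuantumFieldTheory.Balaban1983to89.B5Prop11Lower (nsq nsq_nonneg Lap)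
open Literature.MathematicalPhysics.QuantumFieldTheory.Balaban1983to89.B5Action121 (GradOp)
open Literature.MathematicalPhysics.QuantumFieldTheory.Balaban1983to89.B5Block118 (QvOp bpt tstep)
open Literature.MathematicalPhysics.QuantumFieldTheory.Balaban1983to89.B5Blocks16 (blockOf)
open Literature.MathematicalPhysics.QuantumFieldTheory.Balaban1983to89.B5Value126 (PcT)
open Literature.MathematicalPhysics.QuantumFieldTheory.Balaban1983to89.B5DeltaA169 (QvAdj DeltaA calG_eq_DeltaA_inv isUnit_DeltaA DeltaA_isHermitian)
open Literature.MathematicalPhysics.QuantumFieldTheory.Balaban1983to89.Beta.DeltaACombesThomas (ctRowDefect ctRowDefect_smul gammaA gammaA_pos re_form_DeltaA_ge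
  ctRowDefect_Lap_le_uniform ctRowDefect_QvAdj_QvOp_le)
open Literature.MathematicalPhysics.QuantumFieldTheory.Balaban1983to89.Beta.DeltaACombesThomasSets (stencil_osc_of_lipschitz)
open Literature.MathematicalPhysics.QuantumFieldTheory.Balaban1983to89.Beta.TorusG0Decay (ldist ldist_self)
open Literature.MathematicalPhysics.QuantumFieldTheory.Balaban1983to89.Beta.CombesThomasFormOp (distTo le_distTo distTo_le_zero_of_mem)
open Summit.QuantumFields.BalabanUV.Beta.AccretiveCombesThomas (nsq_single)
open Summit.QuantumFields.BalabanUV.T4Continuum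
open Summit.QuantumFields.BalabanUV.T4Continuum.ScalarAveragedPropagator (gammaPs)
open Summit.QuantumFields.BalabanUV.T4Continuum.ScalarAveragedCompression (sigma0)
open Summit.QuantumFields.BalabanUV.T4Continuum.ScalarCovariantCoercive (rhoS rhoS_lipschitz rhoS_osc)
open Summit.QuantumFields.BalabanUV.T4Continuum.CTWeightedCoercivity
open Summit.QuantumFields.BalabanUV.T4Continuum.CTConjugationTorus (bondW₀)
open Summit.QuantumFields.BalabanUV.T4Continuum.CTScalarGreen (Jfree)
open Summit.QuantumFields.BalabanUV.T4Continuum.CTGaugeTerm (deltaK EK opNorm_conjMat_gaugeTerm_sub_le)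

variable {d : ℕ} (n : ℕ) [NeZero n] (M : Fin d → ℕ) [hM : ∀ μ, NeZero (M μ)]
variable {ρ₀ : Tor (fine n M) → ℝ} {κ a a' Λ : ℝ}

/-! ## §1 The conjugation defect and the weighted coercivity of `Δ_a` -/

/-- **conjugation defect of the Laplacian**: `d·κ²·e^{κ²/2}` for a `1/n`-Lipschitz site weight lifted to bonds. [folklore] -/
theorem conjDefect_Lap (hlip : ∀ x ν, |ρ₀ (x + unitVec (fine n M) ν) - ρ₀ x| ≤ 1 / n) :
    ConjDefect (Lap n M) κ (bondW₀ n M ρ₀) (d * κ ^ 2 * Real.exp (κ ^ 2 / 2)) := by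
  have hn : 1 ≤ n := Nat.one_le_iff_ne_zero.mpr (NeZero.ne n)
  exact conjDefect_of_rowDefect (Literature.MathematicalPhysics.QuantumFieldTheory.Balaban1983to89.B5RealFields.Lap_isHermitian n M) fun e => ctRowDefect_Lap_le_uniform n M hn (bondW₀ n M ρ₀) (fun x μ ν => hlip x ν) e

omit [NeZero n] in
/-- `a·Q*Q` is Hermitian (`Q* = n^dQᴴ`, `a` real). [folklore] -/
theorem mass_isHermitian (a : ℝ) : ((a : ℂ) • (QvAdj n M * QvOp n M)).IsHermitian := by
  have h : (QvAdj n M * QvOp n M).IsHermitian := by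
    rw [QvAdj, Matrix.smul_mul]
    refine (Matrix.isHermitian_conjTranspose_mul_self _).smul ?_
    rw [IsSelfAdjoint, star_pow, Complex.star_def, Complex.conj_natCast]
  exact h.smul (by rw [IsSelfAdjoint, Complex.star_def, Complex.conj_ofReal])

/-- **conjugation defect of the mass term**: `|a|·(cosh(2(d+1)κ) − 1)` (stencil oscillation `2(d+1)` of a `1/n`-Lipschitz bond weight). [folklore] -/
theorem conjDefect_mass (hlip : ∀ x ν, |ρ₀ (x + unitVec (fine n M) ν) - ρ₀ x| ≤ 1 / n) (a : ℝ) :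
    ConjDefect ((a : ℂ) • (QvAdj n M * QvOp n M)) κ (bondW₀ n M ρ₀) (|a| * (Real.cosh (κ * (2 * ((d : ℝ) + 1))) - 1)) := by
  have hn0 : (0 : ℝ) < n := by exact_mod_cast Nat.pos_of_ne_zero (NeZero.ne n)
  have hL : ∀ (y : Tor M) (μ : Fin d) (j j' : Fin d → Fin n) (t t' : Fin n),
      |bondW₀ n M ρ₀ (bpt n M y j + tstep (fine n M) μ t, μ) - bondW₀ n M ρ₀ (bpt n M y j' + tstep (fine n M) μ t', μ)| ≤ 2 * ((d : ℝ) + 1) := by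
    intro y μ j j' t t'
    have h := stencil_osc_of_lipschitz n M (bondW₀ n M ρ₀) (ℓ := 1 / n) (by positivity) (fun x μ ν => hlip x ν) y μ j j' t t'
    have heq : 2 * (((d : ℝ) + 1) * n) * (1 / n) = 2 * ((d : ℝ) + 1) := by field_simp
    rwa [heq] at h
  refine conjDefect_of_rowDefect (mass_isHermitian n M a) fun e => ?_
  rw [ctRowDefect_smul, Complex.norm_real, Real.norm_eq_abs]
  exact mul_le_mul_of_nonneg_left (ctRowDefect_QvAdj_QvOp_le n M (bondW₀ n M ρ₀) hL e) (abs_nonneg a)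

/-- **conjugation defect of the gauge term** `−∂PcT∂ᴴ`: `EK d a′ κ Λ` (SOURCE 2, operator norm). [folklore] -/
theorem conjDefect_gaugeTerm (ha' : 0 < a') (hΛ : 0 ≤ Λ) (hlip : ∀ x ν, |ρ₀ (x + unitVec (fine n M) ν) - ρ₀ x| ≤ 1 / n)
    (hosc : ∀ x x', blockOf n M x = blockOf n M x' → |ρ₀ x - ρ₀ x'| ≤ Λ) (hγ : Jfree d a' κ Λ < gammaPs d a') (hδ : deltaK d a' κ Λ < sigma0 d a' ^ 2) :
    ConjDefect (-(GradOp (fine n M) (n : ℂ) * PcT n M (n : ℂ) * (GradOp (fine n M) (n : ℂ))ᴴ)) κ (bondW₀ n M ρ₀) (EK d a' κ Λ) := by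
  refine conjDefect_of_opNorm ?_
  have e : conjMat κ (bondW₀ n M ρ₀) (bondW₀ n M ρ₀) (-(GradOp (fine n M) (n : ℂ) * PcT n M (n : ℂ) * (GradOp (fine n M) (n : ℂ))ᴴ))
      - -(GradOp (fine n M) (n : ℂ) * PcT n M (n : ℂ) * (GradOp (fine n M) (n : ℂ))ᴴ)
      = -(conjMat κ (bondW₀ n M ρ₀) (bondW₀ n M ρ₀) (GradOp (fine n M) (n : ℂ) * PcT n M (n : ℂ) * (GradOp (fine n M) (n : ℂ))ᴴ)
          - GradOp (fine n M) (n : ℂ) * PcT n M (n : ℂ) * (GradOp (fine n M) (n : ℂ))ᴴ) := by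
    rw [show -(GradOp (fine n M) (n : ℂ) * PcT n M (n : ℂ) * (GradOp (fine n M) (n : ℂ))ᴴ)
        = (-1 : ℂ) • (GradOp (fine n M) (n : ℂ) * PcT n M (n : ℂ) * (GradOp (fine n M) (n : ℂ))ᴴ) by rw [neg_one_smul], conjMat_smul]
    simp only [neg_one_smul, neg_sub_neg, neg_sub]
  rw [e, norm_neg]
  exact opNorm_conjMat_gaugeTerm_sub_le n M ha' hΛ hlip hosc hγ hδ

/-- **THE BUDGET OF `Δ_a`**: `JA d a a′ κ Λ = d·κ²e^{κ²/2} + EK d a′ κ Λ + |a|·(cosh(2(d+1)κ) − 1)`. [folklore] -/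
def JA (d : ℕ) (a a' κ Λ : ℝ) : ℝ := d * κ ^ 2 * Real.exp (κ ^ 2 / 2) + EK d a' κ Λ + |a| * (Real.cosh (κ * (2 * ((d : ℝ) + 1))) - 1)

/-- **CONJUGATION DEFECT OF `Δ_a`** `≤ JA`. [folklore] -/
theorem conjDefect_DeltaA (ha' : 0 < a') (hΛ : 0 ≤ Λ) (hlip : ∀ x ν, |ρ₀ (x + unitVec (fine n M) ν) - ρ₀ x| ≤ 1 / n)
    (hosc : ∀ x x', blockOf n M x = blockOf n M x' → |ρ₀ x - ρ₀ x'| ≤ Λ) (hγ : Jfree d a' κ Λ < gammaPs d a') (hδ : deltaK d a' κ Λ < sigma0 d a' ^ 2) :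
    ConjDefect (DeltaA n M a) κ (bondW₀ n M ρ₀) (JA d a a' κ Λ) := by
  have h := ((conjDefect_Lap n M (κ := κ) hlip).add (conjDefect_gaugeTerm n M ha' hΛ hlip hosc hγ hδ)).add (conjDefect_mass n M (κ := κ) hlip a)
  rw [DeltaA, sub_eq_add_neg, JA]
  exact h

/-- **WEIGHTED COERCIVITY OF `Δ_a`**: `WCoercive (DeltaA n M a) κ ρ_b (gammaA d a − JA)`. [folklore] -/
theorem wCoercive_DeltaA (ha : 0 < a) (ha' : 0 < a') (hΛ : 0 ≤ Λ) (hlip : ∀ x ν, |ρ₀ (x + unitVec (fine n M) ν) - ρ₀ x| ≤ 1 / n)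
    (hosc : ∀ x x', blockOf n M x = blockOf n M x' → |ρ₀ x - ρ₀ x'| ≤ Λ) (hγ : Jfree d a' κ Λ < gammaPs d a') (hδ : deltaK d a' κ Λ < sigma0 d a' ^ 2) :
    WCoercive (DeltaA n M a) κ (bondW₀ n M ρ₀) (gammaA d a - JA d a a' κ Λ) := by
  have hn : 1 ≤ n := Nat.one_le_iff_ne_zero.mpr (NeZero.ne n)
  exact wCoercive_of_coercive (fun A => re_form_DeltaA_ge n hn M a ha A) (conjDefect_DeltaA n M ha' hΛ hlip hosc hγ hδ)

/-! ## §2 The decay of `𝒢(a) = Δ_a⁻¹`, unconditionally -/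

/-- **PAIRING DECAY OF `𝒢(a)`** with NO (1.126) hypothesis: `|⟨u, 𝒢(a)v⟩| ≤ e^{−κr}/(γ_A − JA)·‖u‖‖v‖` for `v` on bonds with base in `{ρ₀ ≤ 0}` and
`u` on bonds with base in `{ρ₀ ≥ r}`. [folklore] -/
theorem calG_pairing_decay (ha : 0 < a) (ha' : 0 < a') (hΛ : 0 ≤ Λ) (hlip : ∀ x ν, |ρ₀ (x + unitVec (fine n M) ν) - ρ₀ x| ≤ 1 / n)
    (hosc : ∀ x x', blockOf n M x = blockOf n M x' → |ρ₀ x - ρ₀ x'| ≤ Λ) (hγ : Jfree d a' κ Λ < gammaPs d a') (hδ : deltaK d a' κ Λ < sigma0 d a' ^ 2)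
    (hκ : 0 ≤ κ) (hJ : JA d a a' κ Λ < gammaA d a) {u v : Tor (fine n M) × Fin d → ℂ} {r : ℝ}
    (hu : ∀ e, u e ≠ 0 → r ≤ ρ₀ e.1) (hv : ∀ e, v e ≠ 0 → ρ₀ e.1 ≤ 0) :
    ‖star u ⬝ᵥ (calG n (Nat.one_le_iff_ne_zero.mpr (NeZero.ne n)) M a ha *ᵥ v)‖
      ≤ Real.exp (-(κ * r)) / (gammaA d a - JA d a a' κ Λ) * (Real.sqrt (nsq u) * Real.sqrt (nsq v)) := by
  rw [calG_eq_DeltaA_inv]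
  exact (wCoercive_DeltaA n M ha ha' hΛ hlip hosc hγ hδ).pairing_decay_inv (by linarith) hκ hu hv

/-- **SET-TO-SET DECAY OF `𝒢(a)`, unconditionally** (distance weight `ρ₀ = rhoS T = dist_∞(·,T)/n`, `Λ = 1`): `v` on bonds based in `T`, `u` on bonds at
sup-distance `≥ n·r` from `T`. [folklore] -/
theorem calG_setDecay' (ha : 0 < a) (ha' : 0 < a') (h2 : ∀ μ, 2 ≤ fine n M μ) (T : Finset (Tor (fine n M))) (hT : T.Nonempty) (hκ : 0 ≤ κ)
    (hγ : Jfree d a' κ 1 < gammaPs d a') (hδ : deltaK d a' κ 1 < sigma0 d a' ^ 2) (hJ : JA d a a' κ 1 < gammaA d a)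
    {u v : Tor (fine n M) × Fin d → ℂ} {r : ℝ} (hv : ∀ e, v e ≠ 0 → e.1 ∈ T) (hu : ∀ e, u e ≠ 0 → ∀ t ∈ T, (n : ℝ) * r ≤ ldist (fine n M) e.1 t) :
    ‖star u ⬝ᵥ (calG n (Nat.one_le_iff_ne_zero.mpr (NeZero.ne n)) M a ha *ᵥ v)‖
      ≤ Real.exp (-(κ * r)) / (gammaA d a - JA d a a' κ 1) * (Real.sqrt (nsq u) * Real.sqrt (nsq v)) := by
  have hn0 : (0 : ℝ) < n := by exact_mod_cast Nat.pos_of_ne_zero (NeZero.ne n)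
  refine calG_pairing_decay n M ha ha' zero_le_one (rhoS_lipschitz n M h2 T hT) (rhoS_osc n M T hT) hγ hδ hκ hJ ?_ ?_
  · intro e he
    rw [rhoS]
    have h := le_distTo (ldist (fine n M)) T hT (hu e he)
    calc r = 1 / (n : ℝ) * ((n : ℝ) * r) := by field_simp
      _ ≤ 1 / (n : ℝ) * distTo (ldist (fine n M)) T hT e.1 := mul_le_mul_of_nonneg_left h (by positivity)
  · intro e he
    rw [rhoS]
    exact mul_nonpos_iff.mpr (Or.inl ⟨by positivity, distTo_le_zero_of_mem (ldist (fine n M)) (ldist_self _) T hT (hv e he)⟩)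

/-- **ENTRY DECAY OF `𝒢(a)`, unconditionally**: `‖𝒢(a)(e, e′)‖ ≤ e^{−κ·dist_∞(x,x′)/n}/(γ_A − JA)` (`x = e.1`, `x′ = e′.1`). [folklore] -/
theorem calG_entry_decay' (ha : 0 < a) (ha' : 0 < a') (h2 : ∀ μ, 2 ≤ fine n M μ) (hκ : 0 ≤ κ)
    (hγ : Jfree d a' κ 1 < gammaPs d a') (hδ : deltaK d a' κ 1 < sigma0 d a' ^ 2) (hJ : JA d a a' κ 1 < gammaA d a) (e e' : Tor (fine n M) × Fin d) :
    ‖calG n (Nat.one_le_iff_ne_zero.mpr (NeZero.ne n)) M a ha e e'‖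
      ≤ Real.exp (-(κ * (ldist (fine n M) e.1 e'.1 / n))) / (gammaA d a - JA d a a' κ 1) := by
  have hn0 : (0 : ℝ) < n := by exact_mod_cast Nat.pos_of_ne_zero (NeZero.ne n)
  have h := calG_setDecay' n M ha ha' h2 {e'.1} (Finset.singleton_nonempty _) hκ hγ hδ hJ
    (u := Pi.single e (1 : ℂ)) (v := Pi.single e' (1 : ℂ)) (r := ldist (fine n M) e.1 e'.1 / n)
    (fun x hx => by
      have hxe : x = e' := by by_contra hne; exact hx (by simp [hne])
      simp [hxe])
    (fun x hx t ht => by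
      have hxe : x = e := by by_contra hne; exact hx (by simp [hne])
      rw [Finset.mem_singleton] at ht
      rw [hxe, ht]
      have : (n : ℝ) * (ldist (fine n M) e.1 e'.1 / n) = ldist (fine n M) e.1 e'.1 := by field_simp
      rw [this])
  have h1 : star (Pi.single e (1 : ℂ)) ⬝ᵥ (calG n (Nat.one_le_iff_ne_zero.mpr (NeZero.ne n)) M a ha *ᵥ Pi.single e' (1 : ℂ))
      = calG n (Nat.one_le_iff_ne_zero.mpr (NeZero.ne n)) M a ha e e' := by
    rw [Matrix.mulVec_single_one, ← Pi.single_star, star_one, single_dotProduct, one_mul, Matrix.col_apply]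
  rw [h1, nsq_single, nsq_single, Real.sqrt_one, mul_one, mul_one] at h
  exact h

end Summit.QuantumFields.BalabanUV.T4Continuum.CTVectorPropagator

end
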